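import Literature.AlgebraicGeometry.AbelianSchemes.PoincarePullbackTorsion
import Literature.AlgebraicGeometry.AbelianSchemes.IsLambdaOfAtMulAdd
import Literature.AlgebraicGeometry.AbelianSchemes.FibreHomPointsOfFibrePoints
import Literature.AlgebraicGeometry.AbelianSchemes.AbelianSchemeQuotientPoincarePullback
import Literature.AlgebraicGeometry.AbelianVarieties.IsogenyPullbackLambdaSliceOfIsotropic
import Literature.AlgebraicGeometry.AbelianSchemes.PoincarePullbackKernelCountOfQuotient
import Literature.AlgebraicGeometry.AbelianSchemes.AbelianSchemeConstSubgroupQuotientKernel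
import Literature.AlgebraicGeometry.AbelianSchemes.SymplecticLiftOfIsogenyWeil
import HarnessLib

/-!
# The slice `(1_X × λσ(s̄))^*((π × 1_Â)^*𝒫)` on a fibre `X_s̄` IS `π_s̄^*(t_{σ(s̄)}^*𝒪(Θ) ⊗ 𝒪(Θ)⁻¹)` (HECKE-LINK D6, `hiso` plumbing)

Layer `Literature/AlgebraicGeometry/AbelianSchemes`, namespace `Literature.AlgebraicGeometry.AbelianSchemes.AbelianSchemeOver`.
THEOREMS ONLY (no definition, no instance, no named fact).

Setting ([MilneAV2008] I §8; [MumfordFogartyKirwan1994] Ch. 6 §2 Def. 6.2–6.3): `A/S` an abelian scheme with a dual pair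
`D = (Â, 𝒫)` (★ `AbelianSchemeDualPair`), a homomorphism `λ : A → Â` and a second abelian scheme `X/S` with a homomorphism
`π : X → A` (in the application `X = A/K` and `π` the descent of `[n]`, ★ `AbelianSchemeQuotientMulNDescent`).  For a section
`σ ∈ A(S)` and a geometric point `s̄ : Spec Ω → S` the `hiso`/`hfib` binders of the D6 `h4` ∃-package (★
`AbelianSchemeQuotientPoincareStabilizerOfMap.map_le_poincareStabilizerSubgroup`, B-p18 (g17); cell hodgecm-mathlib) read the
Poincaré sheaf along the slice

  `(1_X × λσ(s̄)) : X_s̄ → X ×_S Â`  followed by  `π × 1_Â : X ×_S Â → A ×_S Â`,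

i.e. the module `(1_X × λσ(s̄))^*((π × 1_Â)^*𝒫)` on `X_s̄`.  This file is the PLUMBING identifying that module with the
abelian-VARIETY object the Kummer theory speaks about:

* §1 `restrict_comp_left_eq_valueAt` — the point `(λσ)(s̄) : Spec Ω → Â` is the value `λ̄(σ(s̄))` of ★ `valueAt`;
* §2 **`nonempty_pullback_baseChangeToProd_restrict_whiskerRight_iso_of_isLambdaOfAt`** — if `Θ` witnesses `λ̄ = Λ(𝒪(Θ))` at
  `s̄` (★ `IsLambdaOfAt`), then
  `(1_X × λσ(s̄))^*((π × 1)^*𝒫) ≅ π_s̄^*(t_{σ(s̄)}^*𝒪(Θ) ⊗ 𝒪(Θ)⁻¹)` on `X_s̄`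
  (`π_s̄ = fibreHom π s̄` the homomorphism of fibre abelian varieties): the slice square
  `(1_X × a) ≫ (π × 1) = π_s̄ ≫ (1_A × a)` (★ `DualPair.nonempty_pullback_baseChangeToProd_whiskerRight_iso`), the slice
  `(1_A × λ̄(P))^*𝒫 = 𝒫|_{A_s̄ × {λ̄(P)}}` (★ `sliceAt_obj_eq_pullbackP`) and [MumfordFogartyKirwan1994] Def. 6.2
  «`Λ(L)(x) = T_x^*L ⊗ L⁻¹`» (★ `IsLambdaOfAt.nonempty_iso`);
* §2′ `…_iso_unit_of_…` — hence that slice is TRIVIAL as soon as `π_s̄^*(t_{σ(s̄)}^*𝒪(Θ) ⊗ 𝒪(Θ)⁻¹) ≅ 𝒪` (the output of the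
  Kummer bridge «`K` isotropic for `ē^Θ_n` ⇒ `π^*(t_σ^*Θ − Θ) ∼ 0`», [MumfordAV1970] §23 Thm. 2);
* §3 **`hiso_of_isLambdaOfAt_of_fibre`** — the `hiso` binder of ★ `map_le_poincareStabilizerSubgroup` for the isogeny
  quotient `X := A/K`, `π := mulNDesc`, TOKEN-FOR-TOKEN, from the fibrewise abelian-variety statement;
* §4 (ed. 2) **`hiso_of_isLambdaOfAt_of_weilPairingLevel_eq_one`** — the same with the Kummer bridge (★
  `AbelianVarieties.nonempty_pullback_translateTensorDual_iso_unit_of_forall_weilPairingLevel_eq_one`) and all its side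
  conditions on the quotient's fibres DISCHARGED: `hiso` from a `Θ`-witness of `λ̄` and the `ē^Θ_n`-ISOTROPY of `K(s̄)` alone.

Count-neutral generic capital; HC_CM is proved only modulo the 7 printed citations until rung 0 closes — nothing here is about HC.

## References
* [MilneAV2008] J. S. Milne, *Abelian Varieties* (2008), I §8 (pp. 36–37): the family `(1 × α)^*𝒫` and its slices.
* [MumfordFogartyKirwan1994] D. Mumford, J. Fogarty, F. Kirwan, *Geometric Invariant Theory*, 3rd ed. (1994), Ch. 6 §2
  Definition 6.2–6.3 (p. 120): `Λ(L)(x) = T_x^*L ⊗ L⁻¹`, the induced `λ̄` on geometric fibres.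
* [MumfordAV1970] D. Mumford, *Abelian Varieties* (1970), §15 Thm. 1 (p. 143) and §23 (p. 231): dual isogeny, descent of a
  polarisation through an isogeny with isotropic kernel.
-/

set_option autoImplicit false

noncomputable section

-- `(A.fibre s).left = pullback A.X.hom s = (A.baseChange s).left` and `toSchemeHom (fibreHom π s) = (baseChangeHom π s).left`
-- hold by `rfl` only.
set_option backward.isDefEq.respectTransparency false

universe u

open CategoryTheory CategoryTheory.Limits AlgebraicGeometry MonoidalCategory CartesianMonoidalCategory
open scoped MonObj

namespace Literature.AlgebraicGeometry.AbelianSchemes.AbelianSchemeOver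

open Literature.AlgebraicGeometry.Motives Literature.AlgebraicGeometry.AbelianVarieties Literature.AlgebraicGeometry.Modules

section Generic

variable {S : Scheme.{u}} {X A : AbelianSchemeOver S} (π : X.X ⟶ A.X) [IsMonHom π] (D : A.DualPair)
  (lam : A.X ⟶ D.hat.X) {Ω : Type u} [Field Ω] (s : Spec (.of Ω) ⟶ S)

/-! ## §1 The point `(λσ)(s̄)` is the value `λ̄(σ(s̄))` -/

omit [IsMonHom π] in
/-- The `Ω`-point of `Â` underlying the restriction `(σ ≫ λ)(s̄)` of the section `σ ≫ λ` is the value `λ̄(σ(s̄))` of `λ` at the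
`Ω`-point `σ(s̄)` of the fibre `A_s̄` (both are `s̄ ≫ σ ≫ λ : Spec Ω → Â`; ★ `fibrePointToLeft_restrictPt`).
[cite: MumfordFogartyKirwan1994, Ch. 6 §2 Definition 6.3 (p. 120)] -/
theorem restrict_comp_left_eq_valueAt (σ : A.Sections) :
    (D.hat.restrict s (σ ≫ lam)).left = A.valueAt s D lam (A.restrictPt s σ) := by
  rw [valueAt, fibrePointToLeft_restrictPt, restrict_left, restrict_left, Over.comp_left, Category.assoc]

/-! ## §2 The slice of `(π × 1)^*𝒫` at `λσ(s̄)` on `X_s̄` -/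

/-- **`(1_X × λσ(s̄))^*((π × 1_Â)^*𝒫) ≅ π_s̄^*(t_{σ(s̄)}^*𝒪(Θ) ⊗ 𝒪(Θ)⁻¹)` on the fibre `X_s̄`**, for a homomorphism
`π : X → A` of abelian schemes, a dual pair `(Â, 𝒫)` of `A`, a homomorphism `λ : A → Â`, a section `σ ∈ A(S)`, a
field-valued point `s̄` and a Cartier divisor `Θ` on `A_s̄` witnessing `λ̄ = Λ(𝒪(Θ))` at `s̄` (★ `IsLambdaOfAt`).  Chain:
`(1_X × a)^*(π × 1)^*𝒫 ≅ π_s̄^*((1_A × a)^*𝒫)` (★ `DualPair.nonempty_pullback_baseChangeToProd_whiskerRight_iso`) with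
`a = (λσ)(s̄) = λ̄(σ(s̄))` (§1), `(1_A × λ̄(P))^*𝒫 = 𝒫|_{A_s̄ × {λ̄(P)}}` (★ `sliceAt_obj_eq_pullbackP`), and
`𝒫|_{A_s̄ × {λ̄(P)}} ≅ t_P^*𝒪(Θ) ⊗ 𝒪(Θ)⁻¹` ([MumfordFogartyKirwan1994] Def. 6.2, ★ `IsLambdaOfAt.nonempty_iso`); finally
`π_s̄ = fibreHom π s̄` has underlying scheme morphism `(baseChangeHom π s̄).left` (`rfl`).
[cite: MilneAV2008, I §8 pp. 36–37] [cite: MumfordFogartyKirwan1994, Ch. 6 §2 Definition 6.2 (p. 120)] -/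
theorem nonempty_pullback_baseChangeToProd_restrict_whiskerRight_iso_of_isLambdaOfAt
    (Θ : CartierDivisor (A.fibre s).toAbelianVariety.X.left) (hΘ : A.IsLambdaOfAt s D lam Θ) (σ : A.Sections) :
    Nonempty ((Scheme.Modules.pullback (X.baseChangeToProd D.hat s (D.hat.restrict s (σ ≫ lam)).left (Over.w _))).obj
        ((Scheme.Modules.pullback (π ▷ D.hat.X).left).obj D.P) ≅
      (Scheme.Modules.pullback (AbelianVariety.Hom.toSchemeHom (fibreHom π s))).obj
        (tensorObj
          ((Scheme.Modules.pullback ((A.fibre s).toAbelianVariety.translation (A.restrictPt s σ)).left).obj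
            (A.lineBundleOfDivisor s Θ))
          (Modules.dual (A.lineBundleOfDivisor s Θ)))) := by
  -- `(1_X × a)^*(π × 1)^*𝒫 ≅ π_s̄^*((1_A × a)^*𝒫)`
  obtain ⟨e₁⟩ := D.nonempty_pullback_baseChangeToProd_whiskerRight_iso (X := X) π s
    (D.hat.restrict s (σ ≫ lam)).left (Over.w _)
  -- `(1_A × a)^*𝒫 = 𝒫|_{A_s̄ × {λ̄(σ(s̄))}}`
  have h₂ : D.pullbackP s (D.hat.restrict s (σ ≫ lam)).left (Over.w _) =
      (Scheme.Modules.pullback (A.sliceAt s D lam (A.restrictPt s σ))).obj D.P := by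
    rw [A.sliceAt_obj_eq_pullbackP D s lam (A.restrictPt s σ)]
    exact D.pullbackP_congr s (restrict_comp_left_eq_valueAt D lam s σ) _ _
  -- `𝒫|_{A_s̄ × {λ̄(P)}} ≅ t_P^*𝒪(Θ) ⊗ 𝒪(Θ)⁻¹`
  obtain ⟨e₃⟩ := hΘ (A.restrictPt s σ)
  -- `π_s̄` and `(baseChangeHom π s̄).left` are the same morphism of schemes
  have h₄ : (baseChangeHom π s).left = AbelianVariety.Hom.toSchemeHom (fibreHom π s) := rfl
  exact ⟨e₁ ≪≫ (Scheme.Modules.pullback (baseChangeHom π s).left).mapIso (eqToIso h₂ ≪≫ e₃) ≪≫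
    (Scheme.Modules.pullbackCongr h₄).app _⟩

/-- **The slice `(1_X × λσ(s̄))^*((π × 1_Â)^*𝒫)` on `X_s̄` is TRIVIAL** as soon as the abelian-variety module
`π_s̄^*(t_{σ(s̄)}^*𝒪(Θ) ⊗ 𝒪(Θ)⁻¹)` is trivial for some `Θ` witnessing `λ̄ = Λ(𝒪(Θ))` at `s̄` — the shape in which the Kummer
bridge ([MumfordAV1970] §23 Thm. 2: `K` isotropic for `ē^Θ` ⇒ `π^*(t_σ^*Θ − Θ) ∼ 0` on `A/K`) is delivered.
[cite: MumfordAV1970, §23 (p. 231)] [cite: MilneAV2008, I §8 pp. 36–37] -/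
theorem nonempty_pullback_baseChangeToProd_restrict_whiskerRight_iso_unit_of_isLambdaOfAt
    (Θ : CartierDivisor (A.fibre s).toAbelianVariety.X.left) (hΘ : A.IsLambdaOfAt s D lam Θ) (σ : A.Sections)
    (hunit : Nonempty ((Scheme.Modules.pullback (AbelianVariety.Hom.toSchemeHom (fibreHom π s))).obj
        (tensorObj
          ((Scheme.Modules.pullback ((A.fibre s).toAbelianVariety.translation (A.restrictPt s σ)).left).obj
            (A.lineBundleOfDivisor s Θ))
          (Modules.dual (A.lineBundleOfDivisor s Θ))) ≅ SheafOfModules.unit _)) :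
    Nonempty ((Scheme.Modules.pullback (X.baseChangeToProd D.hat s (D.hat.restrict s (σ ≫ lam)).left (Over.w _))).obj
        ((Scheme.Modules.pullback (π ▷ D.hat.X).left).obj D.P) ≅ SheafOfModules.unit _) := by
  obtain ⟨e⟩ := nonempty_pullback_baseChangeToProd_restrict_whiskerRight_iso_of_isLambdaOfAt π D lam s Θ hΘ σ
  obtain ⟨u⟩ := hunit
  exact ⟨e ≪≫ u⟩

end Generic

/-! ## §3 The `hiso` binder of the D6 `h4` package for `X := A/K`, `π := mulNDesc` -/

section Quotient

variable {S : Scheme.{u}} (A : AbelianSchemeOver S)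
  {Y : Scheme.{u}} (u : S ⟶ Y) (K : Subgroup A.Sections) [IsCommMonObj A.X] {n : ℕ}
  (hK : ∀ σ : K, (σ : A.Sections) ^ n = 1)
  [Finite K] [Y.IsSeparated] [IsSeparated (A.X.hom ≫ u)] [S.IsSeparated]
  (hcov : ∀ x : A.left, ∃ O : (A.translationActionOver u K).StableAffineOpens, x ∈ O.1)
  [LocallyOfFiniteType (A.X.hom ≫ u)] [IsLocallyNoetherian Y]
  (hG : ∃ _ : GrpObj (A.quotientOver u K), IsMonHom (A.quotientMk u K hcov))
  (hsm : Smooth (A.quotientOver u K).hom) (hgc : GeometricallyConnected (A.quotientOver u K).hom)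
  (D : A.DualPair) [IsAffine Y]
  (hfree : ∀ (Ω : Type u) [Field Ω] [IsAlgClosed Ω] (x : Spec (.of Ω) ⟶ A.left) (σ : K), σ ≠ 1 →
    x ≫ (A.translation (σ : A.Sections)).left ≠ x)

/-- **The `hiso` binder of ★ `map_le_poincareStabilizerSubgroup` from the fibrewise Kummer statement.**  For the isogeny
quotient `ψ : A → A/K`, `π : A/K → A` (`ψ ≫ π = [n]`), a dual pair `(Â, 𝒫)` and a homomorphism `λ : A → Â`: if at every
geometric point `s̄` and for every `σ ∈ K` there is a divisor `Θ` on `A_s̄` with `λ̄ = Λ(𝒪(Θ))` at `s̄` and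
`π_s̄^*(t_{σ(s̄)}^*𝒪(Θ) ⊗ 𝒪(Θ)⁻¹) ≅ 𝒪` on `(A/K)_s̄` (the Kummer bridge, [MumfordAV1970] §23 Thm. 2, fed by the `ē^Θ_n`-isotropy
of `K(s̄)`), then `(1_{A/K} × λσ(s̄))^*((π × 1_Â)^*𝒫) ≅ 𝒪` — the fibrewise isotropy `hiso` «`λ(K)(s̄) ⊆ ker (π_s̄)^∨`»,
TOKEN-FOR-TOKEN the binder of ★ `map_le_poincareStabilizerSubgroup`.
[cite: MumfordAV1970, §15 Thm. 1 (p. 143) and §23 (p. 231)] [cite: MilneAV2008, I §8 pp. 36–37] -/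
theorem hiso_of_isLambdaOfAt_of_fibre (lam : A.X ⟶ D.hat.X)
    (h : ∀ (σ : K) ⦃Ω : Type u⦄ [Field Ω] [IsAlgClosed Ω] (s : Spec (.of Ω) ⟶ S),
      ∃ Θ : CartierDivisor (A.fibre s).toAbelianVariety.X.left, A.IsLambdaOfAt s D lam Θ ∧
        haveI := A.isMonHom_mulNDesc u K hK hcov hG hsm hgc hfree
        Nonempty ((Scheme.Modules.pullback (AbelianVariety.Hom.toSchemeHom
            (fibreHom (A := A.quotientBy u K hcov hG hsm hgc) (B := A) (A.mulNDesc u K hK hcov) s))).obj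
          (tensorObj
            ((Scheme.Modules.pullback ((A.fibre s).toAbelianVariety.translation
                (A.restrictPt s (σ : A.Sections))).left).obj (A.lineBundleOfDivisor s Θ))
            (Modules.dual (A.lineBundleOfDivisor s Θ))) ≅ SheafOfModules.unit _)) :
    ∀ (σ : K) ⦃Ω : Type u⦄ [Field Ω] [IsAlgClosed Ω] (s : Spec (.of Ω) ⟶ S),
      Nonempty ((Scheme.Modules.pullback ((A.quotientBy u K hcov hG hsm hgc).baseChangeToProd D.hat s
          (D.hat.restrict s ((σ : A.Sections) ≫ lam)).left (Over.w _))).obj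
        ((Scheme.Modules.pullback ((A.mulNDesc u K hK hcov : (A.quotientBy u K hcov hG hsm hgc).X ⟶ A.X) ▷ D.hat.X).left).obj
          D.P) ≅ SheafOfModules.unit _) := by
  intro σ Ω _ _ s
  haveI := A.isMonHom_mulNDesc u K hK hcov hG hsm hgc hfree
  obtain ⟨Θ, hΘ, hunit⟩ := h σ s
  exact nonempty_pullback_baseChangeToProd_restrict_whiskerRight_iso_unit_of_isLambdaOfAt
    (X := A.quotientBy u K hcov hG hsm hgc) (A.mulNDesc u K hK hcov) D lam s Θ hΘ (σ : A.Sections) hunit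

end Quotient

/-! ## §4 The `hiso` binder from the `ē^Θ_n`-isotropy of `K` on geometric fibres (Kummer bridge discharged) -/

section QuotientKummer

variable {S : Scheme.{u}} (A : AbelianSchemeOver S)
  {Y : Scheme.{u}} (u : S ⟶ Y) (K : Subgroup A.Sections) [IsCommMonObj A.X] {n : ℕ}
  (hK : ∀ σ : K, (σ : A.Sections) ^ n = 1)
  [Finite K] [Y.IsSeparated] [IsSeparated (A.X.hom ≫ u)] [S.IsSeparated]
  (hcov : ∀ x : A.left, ∃ O : (A.translationActionOver u K).StableAffineOpens, x ∈ O.1)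
  [LocallyOfFiniteType (A.X.hom ≫ u)] [IsLocallyNoetherian Y]
  (hG : ∃ _ : GrpObj (A.quotientOver u K), IsMonHom (A.quotientMk u K hcov))
  (hsm : Smooth (A.quotientOver u K).hom) (hgc : GeometricallyConnected (A.quotientOver u K).hom)
  (D : A.DualPair) [IsAffine Y]
  (hfree : ∀ (Ω : Type u) [Field Ω] [IsAlgClosed Ω] (x : Spec (.of Ω) ⟶ A.left) (σ : K), σ ≠ 1 →
    x ≫ (A.translation (σ : A.Sections)).left ≠ x)

include hfree in
/-- **`hiso` FROM ISOTROPY.**  For the isogeny quotient `ψ : A → A/K`, `π : A/K → A` (`ψ ≫ π = [n]`, `A` of relative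
dimension `g`, `n` invertible on the geometric points of `S`), a dual pair `(Â, 𝒫)` and a homomorphism `λ : A → Â`: if at
every geometric point `s̄` there is a divisor `Θ` on `A_s̄` with `λ̄ = Λ(𝒪(Θ))` at `s̄` for which `K(s̄)` is ISOTROPIC for the
level-`n` Weil pairing `ē^Θ_n` (`ē^Θ_n(κ(s̄), σ(s̄)) = 1` for `κ, σ ∈ K`), then the fibrewise isotropy binder `hiso` of ★
`map_le_poincareStabilizerSubgroup` holds: `(1_{A/K} × λσ(s̄))^*((π × 1_Â)^*𝒫) ≅ 𝒪` for every `σ ∈ K` and every `s̄`.  The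
Kummer bridge ★ `AbelianVarieties.nonempty_pullback_translateTensorDual_iso_unit_of_forall_weilPairingLevel_eq_one`
([MumfordAV1970] §23 Thm. 2 / Lang VII Prop. 4) supplies `π_s̄^*(t_{σ(s̄)}^*𝒪(Θ) ⊗ 𝒪(Θ)⁻¹) ≅ 𝒪`, its side conditions being
the quotient's fibre facts: `ψ_s̄ ≫ π_s̄ = [n]` (★ `fibreHom_quotientMk_comp_fibreHom_mulNDesc`), `π_s̄` an isogeny (★
`isIsogeny_fibreHom_quotientMk_and_mulNDesc`), `ψ_s̄` onto on `Ω`-points (★ `quotientBy_ontoFibres`), `ker ψ_s̄(Ω) = K(s̄)` (★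
`comp_quotientMk_eq_one_iff`), `A_s̄(Ω)` `n`-divisible (★ `pow_surjective_of_cast_ne_zero`); then §3.
[cite: MumfordAV1970, §15 Thm. 1 (p. 143) and §23 (p. 231)] [cite: MilneAV2008, I §8 pp. 36–37] -/
theorem hiso_of_isLambdaOfAt_of_weilPairingLevel_eq_one (lam : A.X ⟶ D.hat.X) {g : ℕ} (hA : A.IsOfRelDim g)
    (hn : ∀ ⦃Ω : Type u⦄ [Field Ω] [IsAlgClosed Ω] (_ : Spec (.of Ω) ⟶ S), (n : Ω) ≠ 0)
    (h : ∀ (σ : K) ⦃Ω : Type u⦄ [Field Ω] [IsAlgClosed Ω] (s : Spec (.of Ω) ⟶ S),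
      ∃ Θ : CartierDivisor (A.fibre s).toAbelianVariety.X.left, A.IsLambdaOfAt s D lam Θ ∧
        ∀ [IsDominant (AbelianVariety.Hom.toSchemeHom ((n : ℤ) • 𝟙 (A.fibre s).toAbelianVariety))]
          (κ : K) (x y : (A.fibre s).toAbelianVariety.torsionPoints Ω n),
          (x : (A.fibre s).toAbelianVariety.Points Ω) = A.restrictPt s (κ : A.Sections) →
          (y : (A.fibre s).toAbelianVariety.Points Ω) = A.restrictPt s (σ : A.Sections) →
          (A.fibre s).toAbelianVariety.weilPairingLevel Θ x y = 1) :
    ∀ (σ : K) ⦃Ω : Type u⦄ [Field Ω] [IsAlgClosed Ω] (s : Spec (.of Ω) ⟶ S),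
      Nonempty ((Scheme.Modules.pullback ((A.quotientBy u K hcov hG hsm hgc).baseChangeToProd D.hat s
          (D.hat.restrict s ((σ : A.Sections) ≫ lam)).left (Over.w _))).obj
        ((Scheme.Modules.pullback ((A.mulNDesc u K hK hcov : (A.quotientBy u K hcov hG hsm hgc).X ⟶ A.X) ▷ D.hat.X).left).obj
          D.P) ≅ SheafOfModules.unit _) := by
  refine A.hiso_of_isLambdaOfAt_of_fibre u K hK hcov hG hsm hgc D hfree lam fun σ Ω _ _ s => ?_
  obtain ⟨Θ, hΘ, hiso⟩ := h σ s
  refine ⟨Θ, hΘ, ?_⟩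
  letI : GrpObj (A.quotientOver u K) := (A.quotientBy u K hcov hG hsm hgc).grpObj
  haveI := A.isMonHom_quotientMk u K hcov hG hsm hgc
  haveI := A.isMonHom_mulNDesc u K hK hcov hG hsm hgc hfree
  -- `π_s̄` is an isogeny, hence dominant
  have hisog := A.isIsogeny_fibreHom_quotientMk_and_mulNDesc u K hK hcov hG hsm hgc hfree hA s (hn s)
  haveI : Surjective (AbelianVariety.Hom.toSchemeHom
      (fibreHom (A := A.quotientBy u K hcov hG hsm hgc) (B := A) (A.mulNDesc u K hK hcov) s)) := hisog.2.1
  -- the kernel of `ψ_s̄` on `Ω`-points is `K(s̄)`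
  have hq : ∀ x : A.FibrePoints s, x ≫ A.quotientMk u K hcov = 1 ↔ ∃ τ ∈ (K : Set A.Sections), x = A.restrict s τ := by
    intro x
    rw [A.comp_quotientMk_eq_one_iff u K hcov hG hsm hgc hfree s x]
    exact ⟨fun ⟨τ, hτ⟩ => ⟨τ, τ.2, hτ⟩, fun ⟨τ, hτK, hτ⟩ => ⟨⟨τ, hτK⟩, hτ⟩⟩
  -- the torsion point `σ(s̄)`
  let σ' : (A.fibre s).toAbelianVariety.torsionPoints Ω n := ⟨A.restrictPt s (σ : A.Sections), by
    rw [AbelianVariety.mem_torsionPoints_iff, zpow_natCast]; exact A.restrictPt_pow_eq_one s (hK σ)⟩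
  exact nonempty_pullback_translateTensorDual_iso_unit_of_forall_weilPairingLevel_eq_one
    (ψ := fibreHom (A := A) (B := A.quotientBy u K hcov hG hsm hgc) (A.quotientMk u K hcov) s)
    (π := fibreHom (A := A.quotientBy u K hcov hG hsm hgc) (B := A) (A.mulNDesc u K hK hcov) s)
    (hn s) (A.fibreHom_quotientMk_comp_fibreHom_mulNDesc u K hK hcov hG hsm hgc hfree s)
    ((A.fibre s).toAbelianVariety.pow_surjective_of_cast_ne_zero (hn s))
    (surjective_map_fibreHom_of_forall_fibrePoints s _ (A.quotientBy_ontoFibres u K hcov hG hsm hgc s))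
    {P | ∃ τ ∈ (K : Set A.Sections), P = A.restrictPt s τ}
    (fun a ha => (map_fibreHom_eq_one_iff_of_fibrePoints s _ (K : Set A.Sections) hq a).1 ha)
    Θ σ' (fun κ hκ => by
      obtain ⟨τ, hτK, hκτ⟩ := hκ
      exact hiso ⟨τ, hτK⟩ κ σ' hκτ rfl)

end QuotientKummer

end Literature.AlgebraicGeometry.AbelianSchemes.AbelianSchemeOver

end
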